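import Summits.QuantumFields.YangMills.Theorems.BalabanUVNodesN15KingModelMasslessLimit
import Summits.QuantumFields.YangMills.Theorems.BalabanUVNodesN15KingModelMasslessProperTime
import Summits.QuantumFields.YangMills.Theorems.BalabanUVNodesN15KingModelEuclideanDecay
import Summits.QuantumFields.YangMills.Theorems.BalabanUVNodesN15KingModelTwoPointMonotonicity

/-!
# BalabanUVNodes ∕ N15 — THE KING-MODEL RUNG (PART Ϻ-z): CANONICAL SCALING OF THE MASSLESS BLOCK FIELD — `S₂^{0}(z) = ∫₀^∞Π_μJ_t(z_μ)dt` (parts Ϻ-x = Ϻ-y by uniqueness of limits),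
# the TWO-SIDED power law `Γ((d−1)∕2)∕(4π^{(d+1)∕2}R₊(z)^{d−1}) ≤ S₂^{0}(z) ≤ Γ((d−1)∕2)∕(4π^{(d+1)∕2}R₋(z)^{d−1})` for the covariance of `μ⁰_∞` (Coulomb sandwich in three
# dimensions), coordinatewise monotonicity, and `S₂^{0}(z) → 0` at infinity (Track A, DAG node N15 = NE2; FAN-OUT v1.1 §N15 s3 «KING-MODEL RUNG»; count-neutral)

HONEST FRAMING.  Count-neutral (cell `pub-ymgap`, seat `pub-ymgap-dag-n15-e` g35; `--supports stmt-QuantumFields-27366 --as helper` = K3⁸).  King's `A = 0`, `g = 0` model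
([King1986] C. King, Commun. Math. Phys. **102** (1986) 649–677).  Part Ϻ-x built the massless infinite-volume block field `μ⁰_∞` (`d + 1 ≥ 3`) with covariance `S₂^{0} = sup_{m>0}S₂^{ℝ}_m =
lim_{m↓0}S₂^{ℝ}_m`; part Ϻ-y computed the same limit by dominated convergence as `∫₀^∞Π_μJ_t(z_μ)dt` and sandwiched it between the massless propagators at the two block radii.
Combining: ★★ `S₂^{0}(z) = ∫₀^∞Π_μJ_t(z_μ)dt`; ★★★ **`Γ((d−1)∕2)∕(4π^{(d+1)∕2}R₊(z)^{d−1}) ≤ ∫φ(0)φ(z)dμ⁰_∞ ≤ Γ((d−1)∕2)∕(4π^{(d+1)∕2}R₋(z)^{d−1})`** — the massless block field has EXACTLY the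
canonical scaling dimension `(d−1)∕2`: its two-point function is bounded above and below by the free massless propagator at the nearest ∕ farthest points of the two unit blocks
(`1∕(4πR₊) ≤ S₂^{0} ≤ 1∕(4πR₋)` in three dimensions); ★ `S₂^{0}` is coordinatewise antitone in `|z_μ|` and maximal at `0`; ★★ `S₂^{0}(z) → 0` as `|z| → ∞` (no long-range order).
NOT Bałaban's objects; NOT a node discharge; nothing continuum-Yang–Mills ∕ `ℝ⁴` ∕ OS ∕ Clay.  0 `sorry`, 0 def; standard axioms.

WHAT THIS FILE PROVES (kernel).  ★★ **`kingS2Inf0_eq_integral_prod_tentAvg`**, ★★★ **`massless_le_kingS2Inf0`** (lower power law, every `z`), `kingS2Inf0_two_sided`, ★★ **`covariance_kingFieldInf0_two_sided`**,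
★★ `covariance_kingFieldInf0_coulomb` (`d + 1 = 3`), ★ `kingS2Inf0_anti_abs`, `kingS2Inf0_le_zero_sep`, `tendsto_blockGap_cofinite`, ★★ **`tendsto_kingS2Inf0_cofinite`**, `tendsto_covariance_kingFieldInf0_cofinite`.

HONEST SCOPE.  King's free `K = |Ω| = ∞` massless block field at infinite volume, `d + 1 ≥ 3`.  N15 untouched; counts unmoved.
Locators (use): [King1986] Thm 2.1 (2.22) p.654, (4.5)–(4.8) pp.670–671.
-/

noncomputable section

open scoped BigOperators Topology
open Filter MeasureTheory Set

namespace Summit.QuantumFields.YangMills.BalabanUVNodes.N15KingModelRung.InfiniteVolume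

open Summit.QuantumFields.YangMills.BalabanUVNodes.N15KingModelRung.OptimalDecay
open Summit.QuantumFields.YangMills.BalabanUVNodes.N15KingModelRung.ProperTime
open Literature.Analysis.Fourier (tent)

variable {d : ℕ}

/-- ★★ **`S₂^{0}(z) = ∫₀^∞Π_μJ_t(z_μ)dt`** — the `sup` of part Ϻ-x equals the dominated-convergence limit of part Ϻ-y (uniqueness of limits along `m² ↓ 0`; `d ≥ 2`).
[cite: King1986, Thm 2.1 (2.22) p.654, (4.5) p.670] -/
theorem kingS2Inf0_eq_integral_prod_tentAvg (hd : 2 ≤ d) (z : Fin (d + 1) → ℤ) :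
    kingS2Inf0 z = ∫ t in Ioi (0 : ℝ), ∏ μ, ∫ u : ℝ, tent 1 u * gaussLine t ((z μ : ℝ) - u) :=
  tendsto_nhds_unique (tendsto_kingS2Inf_nhdsGT_zero hd z) (tendsto_kingS2Inf_integral_prod_tentAvg hd z)

/-- ★★★ **THE MASSLESS LOWER POWER LAW, EVERY `z`**: `Γ((d−1)∕2)∕(4π^{(d+1)∕2}R₊(z)^{d−1}) ≤ S₂^{0}(z)`. [cite: King1986, Thm 2.1 (2.22) p.654, (4.5) p.670] -/
theorem massless_le_kingS2Inf0 (hd : 2 ≤ d) (z : Fin (d + 1) → ℤ) :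
    Real.Gamma (((d : ℝ) - 1) / 2) / (4 * Real.pi ^ (((d : ℝ) + 1) / 2) * blockSpan z ^ (d - 1)) ≤ kingS2Inf0 z := by
  rw [kingS2Inf0_eq_integral_prod_tentAvg hd z]
  exact massless_lower_bound hd z

/-- ★★ **TWO-SIDED CANONICAL SCALING**: `Γ((d−1)∕2)∕(4π^{(d+1)∕2}R₊(z)^{d−1}) ≤ S₂^{0}(z) ≤ Γ((d−1)∕2)∕(4π^{(d+1)∕2}R₋(z)^{d−1})` for separated blocks. [cite: King1986, Thm 2.1 (2.22) p.654] -/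
theorem kingS2Inf0_two_sided (hd : 2 ≤ d) {z : Fin (d + 1) → ℤ} (hgap : 0 < blockGap z) :
    Real.Gamma (((d : ℝ) - 1) / 2) / (4 * Real.pi ^ (((d : ℝ) + 1) / 2) * blockSpan z ^ (d - 1)) ≤ kingS2Inf0 z
      ∧ kingS2Inf0 z ≤ Real.Gamma (((d : ℝ) - 1) / 2) / (4 * Real.pi ^ (((d : ℝ) + 1) / 2) * blockGap z ^ (d - 1)) :=
  ⟨massless_le_kingS2Inf0 hd z, kingS2Inf0_le_massless hd hgap⟩

/-- ★★ **The covariance of the massless block field has canonical scaling from both sides**: for separated blocks,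
`Γ((d−1)∕2)∕(4π^{(d+1)∕2}R₊(w−z)^{d−1}) ≤ ∫φ(z)φ(w)dμ⁰_∞ ≤ Γ((d−1)∕2)∕(4π^{(d+1)∕2}R₋(w−z)^{d−1})`. [cite: King1986, Thm 2.1 (2.22) p.654, (4.5) p.670] -/
theorem covariance_kingFieldInf0_two_sided (hd : 2 ≤ d) {z w : Fin (d + 1) → ℤ} (hgap : 0 < blockGap (w - z)) :
    Real.Gamma (((d : ℝ) - 1) / 2) / (4 * Real.pi ^ (((d : ℝ) + 1) / 2) * blockSpan (w - z) ^ (d - 1)) ≤ ∫ ω, ω z * ω w ∂kingFieldInf0 d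
      ∧ ∫ ω, ω z * ω w ∂kingFieldInf0 d ≤ Real.Gamma (((d : ℝ) - 1) / 2) / (4 * Real.pi ^ (((d : ℝ) + 1) / 2) * blockGap (w - z) ^ (d - 1)) := by
  rw [integral_eval_mul_eval_kingFieldInf0 hd z w]
  exact kingS2Inf0_two_sided hd hgap

/-- ★★ **THREE DIMENSIONS — THE COULOMB SANDWICH FOR `μ⁰_∞`**: `1∕(4πR₊(w−z)) ≤ ∫φ(z)φ(w)dμ⁰_∞ ≤ 1∕(4πR₋(w−z))` (separated blocks for the upper half). [cite: King1986, Thm 2.1 (2.22) p.654] -/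
theorem covariance_kingFieldInf0_coulomb {z w : Fin (2 + 1) → ℤ} (hgap : 0 < blockGap (w - z)) :
    (4 * Real.pi * blockSpan (w - z))⁻¹ ≤ ∫ ω, ω z * ω w ∂kingFieldInf0 2 ∧ ∫ ω, ω z * ω w ∂kingFieldInf0 2 ≤ (4 * Real.pi * blockGap (w - z))⁻¹ := by
  rw [integral_eval_mul_eval_kingFieldInf0 le_rfl z w, kingS2Inf0_eq_integral_prod_tentAvg le_rfl (w - z)]
  exact massless_coulomb_sandwich hgap

/-- ★ `S₂^{0}` is coordinatewise antitone in `|z_μ|`: `|z_μ| ≤ |z′_μ|` for all `μ` implies `S₂^{0}(z′) ≤ S₂^{0}(z)` (part Ϻ-g in the limit). [folklore] -/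
theorem kingS2Inf0_anti_abs (hd : 2 ≤ d) {z z' : Fin (d + 1) → ℤ} (h : ∀ μ, |z μ| ≤ |z' μ|) : kingS2Inf0 z' ≤ kingS2Inf0 z :=
  le_of_tendsto_of_tendsto (tendsto_kingS2Inf_nhdsGT_zero hd z') (tendsto_kingS2Inf_nhdsGT_zero hd z)
    (eventually_nhdsWithin_of_forall fun _ hm2 => kingS2Inf_anti_abs hm2 h)

/-- `S₂^{0}(z) ≤ S₂^{0}(0)`. [folklore] -/
theorem kingS2Inf0_le_zero_sep (hd : 2 ≤ d) (z : Fin (d + 1) → ℤ) : kingS2Inf0 z ≤ kingS2Inf0 (0 : Fin (d + 1) → ℤ) :=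
  kingS2Inf0_anti_abs hd fun μ => by simp

/-- The inter-block gap `R₋(z) → ∞` as `z → ∞` in `ℤ^{d+1}`. [folklore] -/
theorem tendsto_blockGap_cofinite : Tendsto (fun z : Fin (d + 1) → ℤ => blockGap z) cofinite atTop := by
  have h := tendsto_atTop_add_const_right cofinite (-Real.sqrt (d + 1)) (tendsto_euclidNorm_cofinite (d := d))
  exact tendsto_atTop_mono (fun z => by rw [← sub_eq_add_neg]; exact norm_sub_le_blockGap z) h

/-- ★★ **NO LONG-RANGE ORDER IN THE MASSLESS BLOCK FIELD**: `S₂^{0}(z) → 0` as `z → ∞` in `ℤ^{d+1}` (`d ≥ 2`; squeeze with the power law). [cite: King1986, Thm 2.1 (2.22) p.654] -/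
theorem tendsto_kingS2Inf0_cofinite (hd : 2 ≤ d) : Tendsto (fun z : Fin (d + 1) → ℤ => kingS2Inf0 z) cofinite (𝓝 0) := by
  have hG := tendsto_blockGap_cofinite (d := d)
  have hden : Tendsto (fun z : Fin (d + 1) → ℤ => 4 * Real.pi ^ (((d : ℝ) + 1) / 2) * blockGap z ^ (d - 1)) cofinite atTop :=
    ((tendsto_pow_atTop (by omega : d - 1 ≠ 0)).comp hG).const_mul_atTop (by positivity)
  have hup : Tendsto (fun z : Fin (d + 1) → ℤ => Real.Gamma (((d : ℝ) - 1) / 2) / (4 * Real.pi ^ (((d : ℝ) + 1) / 2) * blockGap z ^ (d - 1))) cofinite (𝓝 0) :=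
    tendsto_const_nhds.div_atTop hden
  refine tendsto_of_tendsto_of_tendsto_of_le_of_le' tendsto_const_nhds hup (Eventually.of_forall fun z => (kingS2Inf0_pos hd z).le) ?_
  filter_upwards [hG.eventually_gt_atTop 0] with z hz
  exact kingS2Inf0_le_massless hd hz

/-- ★ The same for the covariance of `μ⁰_∞`: `∫φ(0)φ(z)dμ⁰_∞ → 0` as `z → ∞`. [folklore] -/
theorem tendsto_covariance_kingFieldInf0_cofinite (hd : 2 ≤ d) :
    Tendsto (fun z : Fin (d + 1) → ℤ => ∫ ω, ω 0 * ω z ∂kingFieldInf0 d) cofinite (𝓝 0) := by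
  have h := tendsto_kingS2Inf0_cofinite hd
  refine h.congr fun z => ?_
  rw [integral_eval_mul_eval_kingFieldInf0 hd 0 z, sub_zero]

end Summit.QuantumFields.YangMills.BalabanUVNodes.N15KingModelRung.InfiniteVolume
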